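import Summits.BirchSwinnertonDyer.BirchSwinnertonDyer.Theorems.KatoDescentTamePotSupersingularTameUpperDefectBillCount
import Summits.BirchSwinnertonDyer.BirchSwinnertonDyer.Theorems.KatoDescentTamePotSupersingularTameUpperOptimalSharpNodesMult
import HarnessLib

/-!
# Route `KatoDescentTamePotSupersingular` (rung K8, sub-rung B4 (t′), cell `bsd-potss`): the U₀ BILL v9 of item
# stmt-BirchSwinnertonDyer-19982 `TameUpperDefectRankZero` — BY NAME from held / closed route items, the DISPLAYED
# Jetchev irreducible reading in `cor15` vocabulary, MULTIPLICATIVE-prime form of referee g28's D-audit sign-off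
# (optimal datum, ONE Tamagawa prime `q ≠ p` with `q ∥ N`, `p ∤ c_p` displayed, tower clause) and Coates–Sujatha's
# (A) on the RESIDUE classes only (a `--supports … --as helper` file; seat `bsd-potss-k8t-c4` g7; nothing booked,
# BSD is not proved by any of this, the item is NOT closed)

Bill v8 (`tameUpperDefectRankZero_bill_of_jetchevReading_of_cruxAResidue_of_heldItems`, p484978) displayed the
Jetchev reading with the Tamagawa prime `q ≠ p` only. After the referee's D-audit sign-off (bsd-potss-ref g28,
`HOME/ref/DAUDIT-SIGNOFF-Hsharp-Jetchev08-ref-g28.md`: PASS; MANDATORY displays «`q ∥ N`» and «`p ∤ c_p ⇒ …`») this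
bill restates U₀ over the MULTIPLICATIVE-prime form of the schema (more binders ⇒ dischargeable by more forms of
the typer's fact), via `TameUpperOptimalSharpNodesMult.upperNonsurjTower_of_jetchevReadingMult_of_cruxAResidue`:

* `hJr` — Jetchev 2008 Cor. 1.5 in the IRREDUCIBLE READING, in the binder vocabulary of the tree's
  `Jetchev2008.cor15_padicValNat_card_primaryComponent_sha_le` (lattice-optimal datum with `p ∤ c`, `p ∤ c_p(E)`,
  `p`-primary `Ш(E/K)`, ONE Tamagawa prime `q ≠ p` with `q ∥ N`; additive potentially good odd `p`, analytic rank
  `0`, non-CM, `E[p]` irreducible, `p`-adic tower not onto) — D-audit PASS (ref g28); NOT a theorem, NOT asserted;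
* `hCS` — Coates–Sujatha's (A) on the RESIDUE classes only: the class has an optimal member (lattice-optimal datum
  at `N_E`) whose Manin constant is divisible by `p` (census-empty) or whose `∏c_ℓ` has its `p`-part on no single
  MULTIPLICATIVE bad prime `q ≠ p` (census: the 3 multi-Tamagawa ♯ rows, all three with fine-unit anchors, g7 census).

Everything else BY NAME as in v7: the route items L₀ `TameLowerHalfRankZero` (19981, deciding), the residual
`TameRankOne` (19984), `KatoTamagawaExactInputs` (19191), `PublishedInputsFineSelmerCM` (19387), the six HELD
`…RedT` children of U₀-red (19203, via the CLOSED glue 19712 `tameUpperReducibleDefectOfCountInputs_proof`), the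
CLOSED split glue 19204 (`tameUpperDefectOfSplit_proof`); the Heegner-road published facts (`gross_zagier`,
`kolyvagin`, Matar–Nekovář, `exists_isNewformOf`, Bump–Friedberg–Hoffstein); Cassels' isogeny invariance is the
held child `PublishedInputCasselsIsogenyRedT` already on the bill. HONEST FRAMING: conditional over items and
displayed hypotheses; nothing asserted; no item is closed; BSD is not advanced by this bookkeeping.

References: [Jetchev2008] Hyp. (∗), Thm. 1.4, Cor. 1.5 (p. 3), Rem. 6.2 (p. 15); [MatarNekovar2019] Thm. 0.3,
§0.11; [Kato2004Asterisque] Thm. 14.5 (3), (14.9.3), Prop. 14.16; [CoatesSujatha2005] Conj. A; [MilneADT2006]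
Thm. I.7.3; [BurungaleFlach2024] Cor. 2; [GrossZagier1986]; [BumpFriedbergHoffstein1990]; [Cassels1965ArithmeticVIII].
-/

set_option autoImplicit false
-- sibling precedent (`KatoDescentTamePotSupersingularAssembly.lean`): the directory name repeats the summit name
set_option linter.dupNamespace false

noncomputable section

open scoped Classical

namespace Summit.BirchSwinnertonDyer.BirchSwinnertonDyer.Theorems

open WeierstrassCurve Literature.NumberTheory.EllipticCurves
  Literature.NumberTheory.EllipticCurves.ModularForms
  Literature.NumberTheory.EllipticCurves.Rank1Residual
  Literature.NumberTheory.EllipticCurves.Rank1Residual.Typed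
  Summit.BirchSwinnertonDyer.Rank1Residual
  Summit.BirchSwinnertonDyer.Rank1Residual.Additive
  Summit.BirchSwinnertonDyer.Rank1Residual.O6
  Summit.BirchSwinnertonDyer.BirchSwinnertonDyer.Theses.KatoDescentTamePotSupersingular

/-- **THE U₀ BILL v9 (item 19982 `TameUpperDefectRankZero`, type = the route decl).** Granted the Heegner-road
published facts (`hGZ`, `hKo`, `hMN`, `hnf`, `hBFH`), the route items `KatoTamagawaExactInputs` (`hK`, 19191),
`PublishedInputsFineSelmerCM` (`hF`, 19387), the deciding crux L₀ `TameLowerHalfRankZero` (`h₂`, 19981), the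
residual `TameRankOne` (`hR`, 19984), the six HELD `…RedT` children of U₀-red (19203, via the closed glue 19712;
`hC₄` = Cassels also feeds the optimal-member transports), the DISPLAYED Jetchev irreducible reading `hJr`
in its MULTIPLICATIVE-prime form (cor15 vocabulary: lattice-optimal datum with `p ∤ c`, `p ∤ c_p(E)`, `p`-primary
`Ш(E/K)`, ONE Tamagawa prime `q ≠ p` with `q ∥ N`; additive potentially good odd `p`, rank `0`, non-CM, irreducible,
tower not onto — NOT a theorem of the tree) and Coates–Sujatha's (A) on the RESIDUE classes only (`hCS`), U₀ holds.
Composition: split glue 19204 ∘ (`TameUpperOptimalSharpNodesMult.upperNonsurjTower_of_jetchevReadingMult_of_cruxAResidue`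
⟹ 19202 body) ∘ (glue 19712 ⟹ 19203). Conditional; nothing asserted; no item is closed.
[cite: Jetchev2008, Hypothesis (*), Thm. 1.4, Cor. 1.5 (p. 3), Rem. 6.2 (p. 15)] [cite: MatarNekovar2019, Thm. 0.3 (p. 456), §0.11 (p. 457)]
[cite: Kato2004Asterisque, Thm. 14.5 (3) (p. 236), (14.9.3) (p. 240), Prop. 14.16 (pp. 244–245)]
[cite: MilneADT2006, Thm. I.7.3 and Remark I.7.4] [cite: CoatesSujatha2005, Conjecture A] [cite: Cassels1965ArithmeticVIII] -/
theorem tameUpperDefectRankZero_bill_of_jetchevReadingMult_of_cruxAResidue_of_heldItems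
    (hGZ : ∀ (N : ℕ) [NeZero N] (W : WeierstrassCurve ℚ) (K : Type) [Field K] [NumberField K],
      gross_zagier N W K)
    (hKo : ∀ (N : ℕ) [NeZero N] (W : WeierstrassCurve ℚ) (K : Type) [Field K] [NumberField K],
      kolyvagin N W K)
    (hMN : ∀ (N : ℕ) [NeZero N] (W : WeierstrassCurve ℚ) (K : Type) [Field K] [NumberField K],
      MatarNekovar2019.thm03_padicValNat_card_sha_le_of_irreducible N W K)
    (hnf : exists_isNewformOf) (hBFH : bumpFriedbergHoffstein_exists_heegnerField_split_twist_simpleZero)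
    (hK : KatoTamagawaExactInputs) (hF : PublishedInputsFineSelmerCM) (h₂ : TameLowerHalfRankZero)
    (hR : TameRankOne)
    (hC₁ : PublishedInputIwasawaH1DataRedT) (hC₂ : PublishedInputNewformKatoRedT)
    (hC₃ : PublishedInputMemberHullCountInputsT) (hC₄ : PublishedInputCasselsIsogenyRedT)
    (hC₅ : PublishedInputRankEqAnalyticRankRedT) (hC₆ : PublishedInputEntireLFunctionRedT)
    (hJr : ∀ (N : ℕ) [NeZero N] (W : WeierstrassCurve ℚ) [W.IsElliptic] [W.IsGloballyMinimal]
      (K : Type) [Field K] [NumberField K],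
      IsImaginaryQuadratic K → NumberField.discr K ≠ -3 → SatisfiesHeegnerHypothesis N K →
      ∀ (p : ℕ) [Fact p.Prime], p ≠ 2 → W.analyticRank = 0 → Addv W p → 0 ≤ padicValRat p W.j →
      ¬ W.HasCM → W.HasIrreducibleModPGaloisRep p → ¬ (∀ n : ℕ, W.HasSurjectiveModNGaloisRep (p ^ n : ℕ)) →
      (∃ Dt : ModularParametrizationData W N,
        (∀ z ∈ Dt.L.lattice, ∃ w ∈ periodLattice Dt.f, z = (Dt.c : ℂ) * w) ∧ ¬ (p : ℤ) ∣ Dt.c) →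
      ¬ p ∣ (W.baseChange ℚ_[p]).localTamagawaNumber ℤ_[p] →
      ∀ {P : (W.baseChange K).toAffine.Point}, IsHeegnerPoint N W K P → ¬ IsOfFinAddOrder P →
      ∀ (q : ℕ) [Fact q.Prime], q ∣ N → ¬ q ^ 2 ∣ N → q ≠ p →
      padicValNat p (Nat.card (AddCommGroup.primaryComponent (W.baseChange K).sha p)) +
          2 * padicValNat p ((W.baseChange ℚ_[q]).localTamagawaNumber ℤ_[q]) ≤
        2 * padicValNat p (AddSubgroup.zmultiples P).index)
    (hCS : ∀ (W : WeierstrassCurve ℚ) [W.IsElliptic] [W.IsGloballyMinimal] (p : ℕ) [Fact p.Prime],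
      W.analyticRank = 0 → p ≠ 2 → Addv W p → SubTprime W p → ¬ W.HasCM →
      W.HasIrreducibleModPGaloisRep p → ¬ (∀ n : ℕ, W.HasSurjectiveModNGaloisRep (p ^ n : ℕ)) →
      (∃ (W₀ : WeierstrassCurve ℚ) (_ : W₀.IsElliptic) (_ : W₀.IsGloballyMinimal)
          (_ : NeZero (W₀.conductorNorm ℤ)) (D₀ : ModularParametrizationData W₀ (W₀.conductorNorm ℤ)),
        IsIsogenous W W₀ ∧ (∀ z ∈ D₀.L.lattice, ∃ w ∈ periodLattice D₀.f, z = (D₀.c : ℂ) * w) ∧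
        ((p : ℤ) ∣ D₀.c ∨ (p ∣ W₀.tamagawaProduct ∧
          ¬ ∃ (q : ℕ) (_ : Fact q.Prime), q ∣ W₀.conductorNorm ℤ ∧ ¬ q ^ 2 ∣ W₀.conductorNorm ℤ ∧ q ≠ p ∧
            padicValNat p W₀.tamagawaProduct ≤
              padicValNat p ((W₀.baseChange ℚ_[q]).localTamagawaNumber ℤ_[q])))) →
      ∀ (κ : ZpExtension ℚ p), κ.IsCyclotomic →
        ∃ (γ : Field.absoluteGaloisGroup ℚ) (D : W.FineSelmerDualData κ γ),
          Module.Finite ℤ_[p] (RestrictScalars ℤ_[p] (IwasawaAlgebra p) D.X)) :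
    Summit.BirchSwinnertonDyer.BirchSwinnertonDyer.Theses.KatoDescentTamePotSupersingular.TameUpperDefectRankZero :=
  tameUpperDefectOfSplit_proof
    (TameUpperOptimalSharpNodesMult.upperNonsurjTower_of_jetchevReadingMult_of_cruxAResidue hJr hGZ hKo hMN hnf
      hBFH hC₄ hCS h₂ hR hK hF)
    (tameUpperReducibleDefectOfCountInputs_proof hC₁ hC₂ hC₃ hC₄ hC₅ hC₆) hK

end Summit.BirchSwinnertonDyer.BirchSwinnertonDyer.Theorems

end
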